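import Summits.ABC.ABC.Theses.FeketeScales
import Summits.ABC.ABC.Theorems.FeketeScalesSparseGoodScalesWieferich
import Literature.NumberTheory.DiophantineGeometry.AbcPrimePowerFamily
import HarnessLib

/-!
# Route FeketeScales — crux `SparseGoodScales` (stmt-ABC-2161): a Wieferich floor for the
# WINDOWED residue (the horizontal stub of line `Sketch`), and why the `∃Λ` residue escapes it

Helper file (`--supports stmt-ABC-2161`, lead seat c11) for the crux `SparseGoodScales` of route
`FeketeScales`.  The two registered lines of this crux split it as (vertical stub) × (horizontal
stub); the horizontal stubs are

* WGS (line `Sketch`, `stub_windowedGoodScales`): for every `δ > 0` and EVERY ratio `Λ > 1` there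
  are arbitrarily large scales `R` such that every abc triple with `rad ≤ R < rad^Λ` has
  `c ≤ R^{1+δ}`;
* DA∃ (line `SketchIdeator4`, `stub_droughtsOfSomeRatio`): the same with SOME ratio `Λ > 1`
  (and `c ≤ rad^{1+δ}`).

The crux itself carries the kernel-checked floor "`SparseGoodScales` ⟹ infinitely many
non-Wieferich primes in every prime base" (`FeketeScalesSparseGoodScalesWieferich.lean`, p99695),
whose mechanism — under "all large primes are Wieferich" the triples `(1, q^{2j} − 1, q^{2j})`
have radical `≤ M q^j` — gives only an UPPER bound on the spoiling radicals, so it says nothing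
about a WINDOW `(R^{1/Λ}, R]` (lead c4's recorded asymmetry: "a window needs a LOWER bound on the
spoiler's radical").  This file supplies the missing lower bound from a TWO-SIDED level hypothesis
and proves:

* `sparseGoodScales_oddWieferichExcess_le_of_levels_le`, `sparseGoodScales_pow_sub_one_le_of_levels_le`
  — if the odd primes of Wieferich level `> L` to base `q` are bounded by `N`, then
  `E_W(q,k) ≤ B · rad(q^k − 1)^{L−1}` and `q^k − 1 ≤ k · rad(q^k − 1)^L · B · 2^{W_2(q)}` for every
  `k ≥ 1` (`B = ∏_{p ≤ N} p^{W_p(q)−1}`), from the sandwich of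
  `PrimePowerRadical/Negative/WieferichValuations.lean`;
* `sparseGoodScales_windowed_infinite_nonWieferich_or_level_gt_of_goodScales` — **THE WINDOWED
  FLOOR**: windowed good scales for ONE exponent `δ < 1` and ALL ratios `Λ > 1` force, for every
  prime `q` and every `L`, infinitely many primes `p` that are either NON-Wieferich to base `q` or
  of level `W_p(q) > L`; `sparseGoodScales_windowed_imp_infinite_nonWieferich_or_level_gt` — the
  same from the registered stub signature WGS of line `Sketch`.

Reading.  (i) The rung `L = 2` at `q = 2` is a THEOREM (companion file
`FeketeScalesSparseGoodScalesOddLevel.lean`: infinitely many primes have ODD base-2 Wieferich level,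
because `2^ℓ − 1 ≡ 3 (mod 4)` is never a square).  For `q = 2` the rungs `L ≥ 3` ("infinitely many
primes `p` with `2^{p−1} ≢ 1 (mod p²)` or `2^{p−1} ≡ 1 (mod p^{L+1})`") are implied by the
infinitude of non-Wieferich primes, and also by Ribenboim's open (M′) "infinitely many Mersenne
numbers are not powerful" (The Book of Prime Number Records (1989), Ch. 5 §III); this tree and its
sources hold no unconditional proof of any of them: their negation says that every Mersenne number
`2^ℓ − 1` with `ℓ` prime and large is powerful with all exponents in `[2, L]`, which no congruence
on `2^ℓ − 1` excludes (every residue class of units contains perfect powers) and which only abc-type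
input is known to forbid.  So the windowed residue WGS is, standalone, at least as hard as these
open rungs — it is not merely "engine-less".  (ii) The same bookkeeping reaches a drought statement
with a FIXED ratio `Λ` only for `L < 2Λ` (the spoiling radicals lie in `[q^{2j/L − o(j)}, M q^j]`,
dense in ratio `Λ` only when `2Λ > L`); for the `∃Λ` residue DA∃ the witness may be any `Λ ≤ 3/2`,
where the only rung reached is `L = 2` — a theorem.  So DA∃ escapes every floor of this family:
the `∃Λ` weakening of line `SketchIdeator4` is exactly what separates "open-problem-hard
standalone" (WGS) from "engine-less standalone" (DA∃); in-route both are abc-equivalent given the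
vertical stub (`FeketeScalesSparseGoodScalesMinimalResidue.lean`, p111037).
-/

-- `Summit.<Summit>.<Problem>` is the mandated summit-side namespace (CONVENTIONS §2); for the
-- single-conjunct summit `ABC` the two coincide, so the duplicate `ABC.ABC` is deliberate.
set_option linter.dupNamespace false

noncomputable section

namespace Summit.ABC.ABC.Theorems

open Literature.NumberTheory.DiophantineGeometry UniqueFactorizationMonoid
open Summit.ABC.ABC.Theses.FeketeScales
open Summit.ABC.ABC.Theorems.PrimePowerRadical.Negative

/-! ## Bounded levels bound the Wieferich excess by a power of the radical -/

/-- **Levels `≤ L` beyond `N` bound the odd Wieferich excess by `rad^{L−1}`.**  If every odd prime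
of Wieferich level `> L` to base `q` is `≤ N`, then for every `k`,
`E_W(q,k) ≤ (∏_{p ≤ N prime} p^{W_p(q) − 1}) · rad(q^k − 1)^{L−1}`: the small primes contribute at
most the fixed product, each large prime `p ∣ q^k − 1` contributes `p^{W_p − 1} ≤ p^{L−1}`. [folklore] -/
theorem sparseGoodScales_oddWieferichExcess_le_of_levels_le {q k N L : ℕ}
    (hN : ∀ p : ℕ, p.Prime → p ≠ 2 → L < wieferichLevel q p → p ≤ N) :
    oddWieferichExcess q k ≤
      (∏ p ∈ (Finset.range (N + 1)).filter Nat.Prime, p ^ (wieferichLevel q p - 1)) *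
        radical (q ^ k - 1) ^ (L - 1) := by
  unfold oddWieferichExcess
  set S := (q ^ k - 1).primeFactors.erase 2 with hS
  have hSp : ∀ p ∈ S, p.Prime := fun p hp =>
    Nat.prime_of_mem_primeFactors (Finset.mem_of_mem_erase hp)
  rw [← Finset.prod_filter_mul_prod_filter_not S (fun p => p ≤ N)]
  apply Nat.mul_le_mul
  · -- the small primes
    apply Finset.prod_le_prod_of_subset_of_one_le'
    · intro p hp
      rw [Finset.mem_filter] at hp ⊢
      exact ⟨Finset.mem_range.mpr (by omega), hSp p hp.1⟩
    · intro p hp _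
      exact Nat.one_le_pow _ _ (Finset.mem_filter.mp hp).2.pos
  · -- the large primes: each exponent is `≤ L − 1`
    have h1 : ∏ p ∈ S.filter (fun p => ¬ p ≤ N), p ^ (wieferichLevel q p - 1) ≤
        ∏ p ∈ S.filter (fun p => ¬ p ≤ N), p ^ (L - 1) := by
      apply Finset.prod_le_prod (fun p _ => Nat.zero_le _)
      intro p hp
      rw [Finset.mem_filter] at hp
      obtain ⟨hpS, hpN⟩ := hp
      have hp : p.Prime := hSp p hpS
      have hp2 : p ≠ 2 := (Finset.mem_erase.mp hpS).1
      have hWL : wieferichLevel q p ≤ L := by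
        by_contra hlt
        exact hpN (hN p hp hp2 (lt_of_not_ge hlt))
      exact Nat.pow_le_pow_right hp.pos (by omega)
    have h2 : ∏ p ∈ S.filter (fun p => ¬ p ≤ N), p ≤ radical (q ^ k - 1) := by
      rw [Nat.radical_eq_prod_primeFactors]
      apply Finset.prod_le_prod_of_subset_of_one_le'
      · intro p hp
        exact Finset.mem_of_mem_erase (Finset.mem_filter.mp hp).1
      · intro p hp _
        exact (Nat.prime_of_mem_primeFactors hp).pos
    calc ∏ p ∈ S.filter (fun p => ¬ p ≤ N), p ^ (wieferichLevel q p - 1)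
        ≤ ∏ p ∈ S.filter (fun p => ¬ p ≤ N), p ^ (L - 1) := h1
      _ = (∏ p ∈ S.filter (fun p => ¬ p ≤ N), p) ^ (L - 1) := Finset.prod_pow _ _ _
      _ ≤ radical (q ^ k - 1) ^ (L - 1) := Nat.pow_le_pow_left h2 _

/-- **Two-sided sandwich under bounded levels.**  For a prime `q`, `k ≥ 1`, `L ≥ 1`: if every odd
prime of Wieferich level `> L` to base `q` is `≤ N`, then
`q^k − 1 ≤ k · rad(q^k − 1)^L · (∏_{p ≤ N prime} p^{W_p(q) − 1}) · 2^{W_2(q)}` — the upper half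
`q^k − 1 ∣ k · rad · E_W · 2^{W_2}` of the sandwich with `E_W ≤ B · rad^{L−1}`.  This is the LOWER
bound on `rad(q^k − 1)` (of order `q^{k/L}`) that a window argument needs. [folklore] -/
theorem sparseGoodScales_pow_sub_one_le_of_levels_le {q k N L : ℕ} (hq : q.Prime) (hk : 1 ≤ k)
    (hL : 1 ≤ L) (hN : ∀ p : ℕ, p.Prime → p ≠ 2 → L < wieferichLevel q p → p ≤ N) :
    q ^ k - 1 ≤ k * radical (q ^ k - 1) ^ L *
      ((∏ p ∈ (Finset.range (N + 1)).filter Nat.Prime, p ^ (wieferichLevel q p - 1)) *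
        2 ^ wieferichLevel q 2) := by
  set B := ∏ p ∈ (Finset.range (N + 1)).filter Nat.Prime, p ^ (wieferichLevel q p - 1) with hB
  set r := radical (q ^ k - 1) with hr
  have h := (oddWieferichExcess_sandwich hq hk).2
  have hE : oddWieferichExcess q k ≤ B * r ^ (L - 1) :=
    sparseGoodScales_oddWieferichExcess_le_of_levels_le (k := k) hN
  have hrL : r * r ^ (L - 1) = r ^ L := by
    rw [← pow_succ']
    congr 1
    omega
  calc q ^ k - 1 ≤ k * r * oddWieferichExcess q k * 2 ^ wieferichLevel q 2 := h
    _ ≤ k * r * (B * r ^ (L - 1)) * 2 ^ wieferichLevel q 2 :=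
        Nat.mul_le_mul_right _ (Nat.mul_le_mul_left _ hE)
    _ = k * (r * r ^ (L - 1)) * (B * 2 ^ wieferichLevel q 2) := by ring
    _ = k * r ^ L * (B * 2 ^ wieferichLevel q 2) := by rw [hrL]

/-! ## The windowed floor -/

/-- A prime is never Wieferich to its own base: `q² ∤ q^{q−1} − 1`. [folklore] -/
theorem sparseGoodScales_not_isWieferich_self {q : ℕ} (hq : q.Prime) : ¬ IsWieferich q q := by
  unfold IsWieferich
  intro hmod
  have h1 : 1 ≤ q ^ (q - 1) := Nat.one_le_pow _ _ hq.pos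
  have hd : q ^ 2 ∣ q ^ (q - 1) - 1 := (Nat.modEq_iff_dvd' h1).mp hmod.symm
  have hd' : q ∣ q ^ (q - 1) - 1 := (dvd_pow_self q two_ne_zero).trans hd
  have hd'' : q ∣ q ^ (q - 1) := dvd_pow_self q (by have := hq.two_le; omega)
  have h3 := Nat.dvd_sub hd'' hd'
  rw [Nat.sub_sub_self h1] at h3
  exact hq.one_lt.ne' (Nat.dvd_one.mp h3)

/-- **THE WINDOWED FLOOR.**  If for some `δ < 1` and EVERY ratio `Λ > 1` there are arbitrarily large
scales `R` at which every abc triple with `rad ≤ R < rad^Λ` has `c ≤ R^{1+δ}` (windowed good scales),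
then for every prime `q` and every `L` there are infinitely many primes `p` which are either
non-Wieferich to base `q` or of Wieferich level `W_p(q) > L`.  Proof: otherwise beyond some `P₀`
every odd prime has level in `[2, L']` (`L' = max L 2`).  Upper side (levels `≥ 2`,
`sparseGoodScales_rad_family_le_of_levels_ge`): `rad(1·(q^{2j}−1)·q^{2j}) ≤ M q^j`, `M = 2Pq`.
Lower side (levels `≤ L'`, `sparseGoodScales_pow_sub_one_le_of_levels_le`):
`q^{2j} − 1 ≤ 2j · rad(q^{2j} − 1)^{L'} · D`.  At a windowed-good scale `R` for the ratio
`Λ = 4L'` take `q^j ≤ R/M < q^{j+1}`: the triple has radical `≤ R`; it lies in the window because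
`R < Mq·q^j` while `rad^{4L'} ≥ ((q^{2j}−1)/(2jD))^4 ≥ q^{8j}/(16 (2jD)^4) > Mq·q^j` once
`q^j > 256 M D^4 q` (forced by `R ≥ Mq · 256 M D^4 q`); so `q^{2j} ≤ R^{1+δ}`, and `R < Mq · q^j`
gives `R² < (Mq)² R^{1+δ}`, i.e. `R^{1−δ} < (Mq)²` — false for large `R`. [folklore] -/
theorem sparseGoodScales_windowed_infinite_nonWieferich_or_level_gt_of_goodScales {δ : ℝ}
    (hδ : δ < 1)
    (h : ∀ Λ : ℝ, 1 < Λ → ∀ N : ℕ, ∃ R : ℕ, N ≤ R ∧ ∀ a b c : ℕ, IsABCTriple a b c →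
      rad a b c ≤ R → (R : ℝ) < ((rad a b c : ℕ) : ℝ) ^ Λ → (c : ℝ) ≤ (R : ℝ) ^ (1 + δ))
    (q : ℕ) (hq : q.Prime) (L : ℕ) :
    {p : ℕ | p.Prime ∧ (¬ IsWieferich q p ∨ L < wieferichLevel q p)}.Infinite := by
  -- WLOG `L ≥ 2`
  set L' : ℕ := max L 2 with hL'
  have hLL' : L ≤ L' := le_max_left _ _
  have hL'2 : 2 ≤ L' := le_max_right _ _
  suffices hsuff : {p : ℕ | p.Prime ∧ (¬ IsWieferich q p ∨ L' < wieferichLevel q p)}.Infinite by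
    refine hsuff.mono ?_
    rintro p ⟨hp, hor⟩
    exact ⟨hp, hor.imp_right fun h' => lt_of_le_of_lt hLL' h'⟩
  intro hfin
  obtain ⟨P₀, hP₀⟩ := hfin.bddAbove
  -- `q` itself is in the set, so `P₀ ≥ q`
  have hqP : q ≤ P₀ := hP₀ ⟨hq, Or.inl (sparseGoodScales_not_isWieferich_self hq)⟩
  -- beyond `P₀` every odd prime is Wieferich of level `≤ L'`
  have hlev : ∀ p : ℕ, p.Prime → p ≠ 2 → P₀ < p →
      2 ≤ wieferichLevel q p ∧ wieferichLevel q p ≤ L' := by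
    intro p hp hp2 hpP
    have hpq : ¬ p ∣ q := fun hd => by
      have := Nat.le_of_dvd hq.pos hd
      omega
    have hnot : ¬ (¬ IsWieferich q p ∨ L' < wieferichLevel q p) := fun hor => by
      have := hP₀ ⟨hp, hor⟩
      omega
    push Not at hnot
    exact ⟨(isWieferich_iff_two_le_wieferichLevel hq.two_le hp hp2 hpq).mp hnot.1, hnot.2⟩
  have hW2 : ∀ k p : ℕ, p.Prime → p ≠ 2 → P₀ < p → p ∣ q ^ k - 1 → 2 ≤ wieferichLevel q p :=
    fun _ p hp hp2 hpP _ => (hlev p hp hp2 hpP).1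
  have hWL : ∀ p : ℕ, p.Prime → p ≠ 2 → L' < wieferichLevel q p → p ≤ P₀ := by
    intro p hp hp2 hlt
    by_contra hle
    have := (hlev p hp hp2 (lt_of_not_ge hle)).2
    omega
  -- constants: `P`, `M = 2Pq` (upper side), `B`, `D = B · 2^{W_2(q)}` (lower side)
  set P : ℕ := ∏ p ∈ (Finset.range (P₀ + 1)).filter Nat.Prime, p with hP
  have hP0 : P ≠ 0 :=
    Finset.prod_ne_zero_iff.mpr fun p hp => (Finset.mem_filter.mp hp).2.ne_zero
  set M : ℕ := 2 * P * q with hM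
  have hq0 : 0 < q := hq.pos
  have hM0 : 0 < M := by
    rw [hM]; exact Nat.mul_pos (Nat.mul_pos two_pos (Nat.pos_of_ne_zero hP0)) hq0
  have hfam : ∀ j : ℕ, 1 ≤ j → rad 1 (q ^ (2 * j) - 1) (q ^ (2 * j)) ≤ M * q ^ j := by
    intro j hj
    have := sparseGoodScales_rad_family_le_of_levels_ge hq (n := 2) (by norm_num) P₀ hW2 j hj
    rw [hM]; exact this
  set B : ℕ := ∏ p ∈ (Finset.range (P₀ + 1)).filter Nat.Prime, p ^ (wieferichLevel q p - 1)
    with hB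
  have hB0 : 0 < B :=
    Finset.prod_pos fun p hp => pow_pos (Finset.mem_filter.mp hp).2.pos _
  set D : ℕ := B * 2 ^ wieferichLevel q 2 with hD
  have hD0 : 0 < D := Nat.mul_pos hB0 (pow_pos two_pos _)
  have hlow : ∀ k : ℕ, 1 ≤ k → q ^ k - 1 ≤ k * radical (q ^ k - 1) ^ L' * D := by
    intro k hk
    have := sparseGoodScales_pow_sub_one_le_of_levels_le hq hk (by omega : 1 ≤ L') hWL
    rw [hD, hB]; exact this
  -- the window constant `Kc = 256 M D^4 q`
  set Kc : ℕ := 256 * M * D ^ 4 * q with hKc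
  have hKc1 : 1 ≤ Kc := by
    have : 0 < Kc := by rw [hKc]; positivity
    omega
  -- real constants: `K = (Mq)²`, exponent `e = 1 − δ > 0`
  set K : ℝ := ((M * q : ℕ) : ℝ) ^ 2 with hK
  have hMq0 : (0 : ℝ) < ((M * q : ℕ) : ℝ) := by exact_mod_cast Nat.mul_pos hM0 hq0
  have hK0 : 0 < K := by rw [hK]; positivity
  set e : ℝ := 1 - δ with he
  have he0 : 0 < e := by rw [he]; linarith
  obtain ⟨N₁, hN₁⟩ := exists_nat_gt (K ^ (1 / e))
  -- the ratio `Λ = 4 L' ≥ 8`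
  set Λ : ℝ := ((4 * L' : ℕ) : ℝ) with hΛ
  have hΛ1 : 1 < Λ := by
    have : (8 : ℕ) ≤ 4 * L' := by omega
    have h8 : ((8 : ℕ) : ℝ) ≤ Λ := by rw [hΛ]; exact_mod_cast this
    push_cast at h8
    linarith
  -- a windowed-good scale beyond all thresholds
  obtain ⟨R, hRN, hgood⟩ := h Λ hΛ1 (max N₁ (M * q * Kc))
  have hRN₁ : N₁ ≤ R := le_trans (le_max_left _ _) hRN
  have hRMK : M * q * Kc ≤ R := le_trans (le_max_right _ _) hRN
  have hRMq : M * q ≤ R := le_trans (Nat.le_mul_of_pos_right _ (by omega)) hRMK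
  -- `j := ⌊log_q (R / M)⌋ ≥ 1`
  have hRM : q ≤ R / M := (Nat.le_div_iff_mul_le hM0).mpr (by rw [mul_comm]; exact hRMq)
  set j : ℕ := Nat.log q (R / M) with hj
  have hj1 : 1 ≤ j := Nat.log_pos hq.one_lt hRM
  have hRM0 : R / M ≠ 0 := by have := hq.two_le; omega
  have hqj : q ^ j ≤ R / M := Nat.pow_log_le_self q hRM0
  have hlt : R / M < q ^ (j + 1) := Nat.lt_pow_succ_log_self hq.one_lt _
  -- the triple `(1, q^{2j} − 1, q^{2j})` sits below the good scale `R`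
  have h2j : 1 ≤ 2 * j := by omega
  have htri : IsABCTriple 1 (q ^ (2 * j) - 1) (q ^ (2 * j)) :=
    isABCTriple_one_pow_sub_one hq.two_le h2j
  have hrad : rad 1 (q ^ (2 * j) - 1) (q ^ (2 * j)) ≤ R :=
    calc rad 1 (q ^ (2 * j) - 1) (q ^ (2 * j)) ≤ M * q ^ j := hfam j hj1
      _ ≤ M * (R / M) := Nat.mul_le_mul_left M hqj
      _ ≤ R := Nat.mul_div_le R M
  -- but `R < M q · q^j`
  have hRlt : R < M * q * q ^ j := by
    have h' : R < q ^ (j + 1) * M := (Nat.div_lt_iff_lt_mul hM0).mp hlt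
    calc R < q ^ (j + 1) * M := h'
      _ = M * q * q ^ j := by ring
  -- hence `q^j > Kc`
  have hKj : Kc < q ^ j := Nat.lt_of_mul_lt_mul_left (lt_of_le_of_lt hRMK hRlt)
  -- THE WINDOW (in `ℕ`): `R < rad(q^{2j} − 1)^{4L'}`
  set r : ℕ := radical (q ^ (2 * j) - 1) with hr
  have hstar : q ^ (2 * j) - 1 ≤ 2 * j * r ^ L' * D := hlow (2 * j) h2j
  have hq2j : 2 ≤ q ^ (2 * j) := two_le_pow_of_two_le hq.two_le h2j
  have hA : q ^ (8 * j) ≤ 16 * (q ^ (2 * j) - 1) ^ 4 := by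
    have h' : q ^ (2 * j) ≤ 2 * (q ^ (2 * j) - 1) := by omega
    calc q ^ (8 * j) = (q ^ (2 * j)) ^ 4 := by rw [← pow_mul]; ring_nf
      _ ≤ (2 * (q ^ (2 * j) - 1)) ^ 4 := Nat.pow_le_pow_left h' 4
      _ = 16 * (q ^ (2 * j) - 1) ^ 4 := by ring
  have hjq : j ≤ q ^ j :=
    le_trans (Nat.lt_two_pow_self).le (Nat.pow_le_pow_left hq.two_le j)
  have hwin : R < r ^ (4 * L') := by
    have hpos : 0 < (2 * j * D) ^ 4 := by positivity
    have h1 : R * (2 * j * D) ^ 4 < M * q * q ^ j * (2 * j * D) ^ 4 :=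
      mul_lt_mul_of_pos_right hRlt hpos
    have h21 : M * q * q ^ j * (2 * j * D) ^ 4 ≤ 16 * M * D ^ 4 * q * q ^ (5 * j) := by
      have hj4 : j ^ 4 ≤ (q ^ j) ^ 4 := Nat.pow_le_pow_left hjq 4
      calc M * q * q ^ j * (2 * j * D) ^ 4 = 16 * M * D ^ 4 * q * (q ^ j * j ^ 4) := by ring
        _ ≤ 16 * M * D ^ 4 * q * (q ^ j * (q ^ j) ^ 4) :=
            Nat.mul_le_mul_left _ (Nat.mul_le_mul_left _ hj4)
        _ = 16 * M * D ^ 4 * q * q ^ (5 * j) := by ring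
    have h22 : 16 * (16 * M * D ^ 4 * q * q ^ (5 * j)) ≤ 16 * (q ^ (2 * j) - 1) ^ 4 := by
      have hj3 : q ^ j ≤ q ^ (3 * j) := Nat.pow_le_pow_right hq0 (by omega)
      calc 16 * (16 * M * D ^ 4 * q * q ^ (5 * j)) = Kc * q ^ (5 * j) := by rw [hKc]; ring
        _ ≤ q ^ j * q ^ (5 * j) := Nat.mul_le_mul_right _ hKj.le
        _ ≤ q ^ (3 * j) * q ^ (5 * j) := Nat.mul_le_mul_right _ hj3
        _ = q ^ (8 * j) := by rw [← pow_add]; ring_nf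
        _ ≤ 16 * (q ^ (2 * j) - 1) ^ 4 := hA
    have h2 : M * q * q ^ j * (2 * j * D) ^ 4 ≤ (q ^ (2 * j) - 1) ^ 4 :=
      le_trans h21 (Nat.le_of_mul_le_mul_left h22 (by norm_num))
    have h3 : (q ^ (2 * j) - 1) ^ 4 ≤ (r ^ L') ^ 4 * (2 * j * D) ^ 4 := by
      calc (q ^ (2 * j) - 1) ^ 4 ≤ (2 * j * r ^ L' * D) ^ 4 := Nat.pow_le_pow_left hstar 4
        _ = (r ^ L') ^ 4 * (2 * j * D) ^ 4 := by ring
    have h4 : R * (2 * j * D) ^ 4 < (r ^ L') ^ 4 * (2 * j * D) ^ 4 :=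
      lt_of_lt_of_le h1 (le_trans h2 h3)
    have h5 : R < (r ^ L') ^ 4 := Nat.lt_of_mul_lt_mul_right h4
    calc R < (r ^ L') ^ 4 := h5
      _ = r ^ (4 * L') := by rw [← pow_mul, mul_comm]
  -- the window in `ℝ`, for the triple's radical `r · q ≥ r`
  have hradT : r ≤ rad 1 (q ^ (2 * j) - 1) (q ^ (2 * j)) := by
    rw [rad_one_pow_sub_one_pow hq h2j]
    exact Nat.le_mul_of_pos_right _ hq0
  have hwinT : R < rad 1 (q ^ (2 * j) - 1) (q ^ (2 * j)) ^ (4 * L') :=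
    lt_of_lt_of_le hwin (Nat.pow_le_pow_left hradT _)
  have hwinR : (R : ℝ) < ((rad 1 (q ^ (2 * j) - 1) (q ^ (2 * j)) : ℕ) : ℝ) ^ Λ := by
    rw [hΛ, Real.rpow_natCast]
    exact_mod_cast hwinT
  have hc := hgood 1 (q ^ (2 * j) - 1) (q ^ (2 * j)) htri hrad hwinR
  -- pass to `ℝ` (as in the scale-dense floor, with `n = 2`)
  have hR0 : (0 : ℝ) < (R : ℝ) := by
    have : 0 < R := lt_of_lt_of_le (Nat.mul_pos hM0 hq0) hRMq
    exact_mod_cast this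
  have hRlt' : (R : ℝ) < ((M * q : ℕ) : ℝ) * (q : ℝ) ^ j := by
    have : ((R : ℕ) : ℝ) < ((M * q * q ^ j : ℕ) : ℝ) := by exact_mod_cast hRlt
    push_cast at this ⊢
    linarith
  have hc' : ((q : ℝ) ^ j) ^ 2 ≤ (R : ℝ) ^ (1 + δ) := by
    have eq : ((q : ℝ) ^ j) ^ 2 = ((q ^ (2 * j) : ℕ) : ℝ) := by
      push_cast
      rw [← pow_mul, mul_comm]
    rw [eq]
    exact hc
  -- `R² < K · R^{1+δ}`
  have hpow : (R : ℝ) ^ (2 : ℕ) < K * (R : ℝ) ^ (1 + δ) := by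
    have h3 : (R : ℝ) ^ (2 : ℕ) < (((M * q : ℕ) : ℝ) * (q : ℝ) ^ j) ^ 2 :=
      pow_lt_pow_left₀ hRlt' hR0.le (by norm_num)
    calc (R : ℝ) ^ (2 : ℕ) < (((M * q : ℕ) : ℝ) * (q : ℝ) ^ j) ^ 2 := h3
      _ = K * ((q : ℝ) ^ j) ^ 2 := by rw [hK, mul_pow]
      _ ≤ K * (R : ℝ) ^ (1 + δ) := mul_le_mul_of_nonneg_left hc' hK0.le
  -- `R^e < K`
  have hsplit : (R : ℝ) ^ (2 : ℕ) = (R : ℝ) ^ (1 + δ) * (R : ℝ) ^ e := by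
    rw [← Real.rpow_add hR0, ← Real.rpow_natCast]
    congr 1
    rw [he]; push_cast; ring
  have hpow1 : (0 : ℝ) < (R : ℝ) ^ (1 + δ) := Real.rpow_pos_of_pos hR0 _
  have hRe : (R : ℝ) ^ e < K := by
    rw [hsplit, mul_comm K] at hpow
    exact lt_of_mul_lt_mul_left hpow hpow1.le
  -- `R < K^{1/e} < N₁ ≤ R`
  have hRK : (R : ℝ) < K ^ (1 / e) := by
    have eq : (R : ℝ) = ((R : ℝ) ^ e) ^ (1 / e) := by
      rw [← Real.rpow_mul hR0.le]
      have : e * (1 / e) = 1 := by field_simp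
      rw [this, Real.rpow_one]
    rw [eq]
    exact Real.rpow_lt_rpow (Real.rpow_nonneg hR0.le _) hRe (by positivity)
  have hN₁' : (N₁ : ℝ) ≤ (R : ℝ) := by exact_mod_cast hRN₁
  linarith

/-- **The windowed floor, read at the registered stub of line `Sketch`.**  The horizontal stub WGS
(`stub_windowedGoodScales`: windowed good scales for every `δ > 0` and every ratio `Λ > 1`)
implies, for every prime `q` and every `L`, infinitely many primes that are non-Wieferich to base
`q` or of Wieferich level `> L` (use `δ = 1/2`).  For `q = 2` the rung `L = 2` is a theorem
(companion file `FeketeScalesSparseGoodScalesOddLevel.lean`); every rung `L ≥ 3` is implied by the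
infinitude of non-Wieferich primes and has no unconditional proof in this tree.  (The statement
is kept on one line: it is the signature registered on stmt-ABC-2161 for this sub-goal.) [folklore] -/
theorem sparseGoodScales_windowed_imp_infinite_nonWieferich_or_level_gt : (∀ δ : ℝ, 0 < δ → ∀ Λ : ℝ, 1 < Λ → ∀ N : ℕ, ∃ R : ℕ, N ≤ R ∧ ∀ a b c : ℕ, Literature.NumberTheory.DiophantineGeometry.IsABCTriple a b c → Literature.NumberTheory.DiophantineGeometry.rad a b c ≤ R → (R : ℝ) < ((Literature.NumberTheory.DiophantineGeometry.rad a b c : ℕ) : ℝ) ^ Λ → (c : ℝ) ≤ (R : ℝ) ^ (1 + δ)) → ∀ q : ℕ, q.Prime → ∀ L : ℕ, {p : ℕ | p.Prime ∧ (¬ Literature.NumberTheory.DiophantineGeometry.IsWieferich q p ∨ L < Summit.ABC.ABC.Theorems.PrimePowerRadical.Negative.wieferichLevel q p)}.Infinite :=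
  fun hW q hq L =>
    sparseGoodScales_windowed_infinite_nonWieferich_or_level_gt_of_goodScales
      (by norm_num : (1 / 2 : ℝ) < 1) (hW (1 / 2) (by norm_num)) q hq L

end Summit.ABC.ABC.Theorems

end
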